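import Summits.Ventures.PercRepro.RankLevelSetCoreSixColoopFree
import Summits.Ventures.PercRepro.RankLevelSetFourCircuitNullityFour

/-!
# PercRepro — THE COLOOP-FREE AVERAGING STEP ON THE CHAIN FROM THE NULLITY-4 CAP `16`, AT RANK `26` (p8 g7, S3)

`proofs/SUBCLAIM-S3-p8.md` §3u. RankLevelSetCoreSixColoopFree's step (a core with no coloop: `m = |E|`) run from
`avgChain16` (RankLevelSetFourCircuitNullityFour: `46 / 69 / 99 / 138 / 188 / 250 / 326 / 419` at nullity `6 … 13`) and
`avgChain5b` on `≥ 26 + d` points: `s₄ ≤ 52 / 78 / 111 / 155 / 210 / 279 / 363 / 465` and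
`s₅ ≤ 275 / 470 / 759 / 1175 / 1755 / 2542 / 3588 / 4949` at nullity `d = 7 … 14` (`s4_cf16_d`, `s5_cf26_d`) — the caps of
the coloop-free cells of THE 26 ROW. Axioms: standard.
-/

open scoped Matroid

namespace PercRepro

namespace ThmN

open Set

variable {α : Type}

/-- **The coloop-free 4-circuit step on the chain from `16`**: on a core of nullity `d + 1` with no coloop and `≥ m ≥ 1`
points, `s₄ − ⌊4·s₄/m⌋ ≤ avgChain16 d`. -/
theorem ncard_fourCircuits_sub_div_le_avgChain16_of_coloopFree (M : Matroid α) [M.Finite]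
    (hfree : ∀ e ∈ M.E, ∃ A ⊆ M.E \ {e}, e ∉ M.closure A ∧ e ∉ M.closure ((M.E \ {e}) \ A))
    (hcf : ∀ e ∈ M.E, ¬ M.IsColoop e) {d : ℕ} (hd : M.E.encard = M.eRank + (d + 1)) {m : ℕ} (hm0 : 0 < m)
    (hm : m ≤ M.E.ncard) :
    {C : Set α | M.IsCircuit C ∧ C.ncard = 4}.ncard -
      4 * {C : Set α | M.IsCircuit C ∧ C.ncard = 4}.ncard / m ≤ avgChain16 d :=
  S1.ncard_fourCircuits_sub_div_le_of_nonColoops M hfree hd hm0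
    (by rw [ncard_nonColoops_eq_of_forall M hcf]; exact hm)
    (fun M' _ hfree' hd' => ncard_fourCircuits_le_avgChain16 d M' hfree' hd')

/-- The chain values used below: `avgChain16 6 … 13 = 46, 69, 99, 138, 188, 250, 326, 419`. -/
theorem avgChain16_values_cf : avgChain16 6 = 46 ∧ avgChain16 7 = 69 ∧ avgChain16 8 = 99 ∧ avgChain16 9 = 138 ∧
    avgChain16 10 = 188 ∧ avgChain16 11 = 250 ∧ avgChain16 12 = 326 ∧ avgChain16 13 = 419 := by decide

/-- **`s₄ ≤ 52` on a coloop-free core of nullity `7` with `≥ 33` points** (`s − ⌊4s/33⌋ ≤ 46`). -/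
theorem s4_cf16_7 (M : Matroid α) [M.Finite]
    (hfree : ∀ e ∈ M.E, ∃ A ⊆ M.E \ {e}, e ∉ M.closure A ∧ e ∉ M.closure ((M.E \ {e}) \ A))
    (hcf : ∀ e ∈ M.E, ¬ M.IsColoop e) (hd : M.E.encard = M.eRank + 7) (hn : 33 ≤ M.E.ncard) :
    {C : Set α | M.IsCircuit C ∧ C.ncard = 4}.ncard ≤ 52 := by
  have h := ncard_fourCircuits_sub_div_le_avgChain16_of_coloopFree M hfree hcf (d := 6) (m := 33)
    (by rw [hd]; norm_num) (by norm_num) hn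
  rw [avgChain16_values_cf.1] at h
  omega

/-- **`s₄ ≤ 78` on a coloop-free core of nullity `8` with `≥ 34` points** (`s − ⌊4s/34⌋ ≤ 69`). -/
theorem s4_cf16_8 (M : Matroid α) [M.Finite]
    (hfree : ∀ e ∈ M.E, ∃ A ⊆ M.E \ {e}, e ∉ M.closure A ∧ e ∉ M.closure ((M.E \ {e}) \ A))
    (hcf : ∀ e ∈ M.E, ¬ M.IsColoop e) (hd : M.E.encard = M.eRank + 8) (hn : 34 ≤ M.E.ncard) :
    {C : Set α | M.IsCircuit C ∧ C.ncard = 4}.ncard ≤ 78 := by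
  have h := ncard_fourCircuits_sub_div_le_avgChain16_of_coloopFree M hfree hcf (d := 7) (m := 34)
    (by rw [hd]; norm_num) (by norm_num) hn
  rw [avgChain16_values_cf.2.1] at h
  omega

/-- **`s₄ ≤ 111` on a coloop-free core of nullity `9` with `≥ 35` points** (`s − ⌊4s/35⌋ ≤ 99`). -/
theorem s4_cf16_9 (M : Matroid α) [M.Finite]
    (hfree : ∀ e ∈ M.E, ∃ A ⊆ M.E \ {e}, e ∉ M.closure A ∧ e ∉ M.closure ((M.E \ {e}) \ A))
    (hcf : ∀ e ∈ M.E, ¬ M.IsColoop e) (hd : M.E.encard = M.eRank + 9) (hn : 35 ≤ M.E.ncard) :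
    {C : Set α | M.IsCircuit C ∧ C.ncard = 4}.ncard ≤ 111 := by
  have h := ncard_fourCircuits_sub_div_le_avgChain16_of_coloopFree M hfree hcf (d := 8) (m := 35)
    (by rw [hd]; norm_num) (by norm_num) hn
  rw [avgChain16_values_cf.2.2.1] at h
  omega

/-- **`s₄ ≤ 155` on a coloop-free core of nullity `10` with `≥ 36` points** (`s − ⌊4s/36⌋ ≤ 138`). -/
theorem s4_cf16_10 (M : Matroid α) [M.Finite]
    (hfree : ∀ e ∈ M.E, ∃ A ⊆ M.E \ {e}, e ∉ M.closure A ∧ e ∉ M.closure ((M.E \ {e}) \ A))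
    (hcf : ∀ e ∈ M.E, ¬ M.IsColoop e) (hd : M.E.encard = M.eRank + 10) (hn : 36 ≤ M.E.ncard) :
    {C : Set α | M.IsCircuit C ∧ C.ncard = 4}.ncard ≤ 155 := by
  have h := ncard_fourCircuits_sub_div_le_avgChain16_of_coloopFree M hfree hcf (d := 9) (m := 36)
    (by rw [hd]; norm_num) (by norm_num) hn
  rw [avgChain16_values_cf.2.2.2.1] at h
  omega

/-- **`s₄ ≤ 210` on a coloop-free core of nullity `11` with `≥ 37` points** (`s − ⌊4s/37⌋ ≤ 188`). -/
theorem s4_cf16_11 (M : Matroid α) [M.Finite]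
    (hfree : ∀ e ∈ M.E, ∃ A ⊆ M.E \ {e}, e ∉ M.closure A ∧ e ∉ M.closure ((M.E \ {e}) \ A))
    (hcf : ∀ e ∈ M.E, ¬ M.IsColoop e) (hd : M.E.encard = M.eRank + 11) (hn : 37 ≤ M.E.ncard) :
    {C : Set α | M.IsCircuit C ∧ C.ncard = 4}.ncard ≤ 210 := by
  have h := ncard_fourCircuits_sub_div_le_avgChain16_of_coloopFree M hfree hcf (d := 10) (m := 37)
    (by rw [hd]; norm_num) (by norm_num) hn
  rw [avgChain16_values_cf.2.2.2.2.1] at h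
  omega

/-- **`s₄ ≤ 279` on a coloop-free core of nullity `12` with `≥ 38` points** (`s − ⌊4s/38⌋ ≤ 250`). -/
theorem s4_cf16_12 (M : Matroid α) [M.Finite]
    (hfree : ∀ e ∈ M.E, ∃ A ⊆ M.E \ {e}, e ∉ M.closure A ∧ e ∉ M.closure ((M.E \ {e}) \ A))
    (hcf : ∀ e ∈ M.E, ¬ M.IsColoop e) (hd : M.E.encard = M.eRank + 12) (hn : 38 ≤ M.E.ncard) :
    {C : Set α | M.IsCircuit C ∧ C.ncard = 4}.ncard ≤ 279 := by
  have h := ncard_fourCircuits_sub_div_le_avgChain16_of_coloopFree M hfree hcf (d := 11) (m := 38)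
    (by rw [hd]; norm_num) (by norm_num) hn
  rw [avgChain16_values_cf.2.2.2.2.2.1] at h
  omega

/-- **`s₄ ≤ 363` on a coloop-free core of nullity `13` with `≥ 39` points** (`s − ⌊4s/39⌋ ≤ 326`). -/
theorem s4_cf16_13 (M : Matroid α) [M.Finite]
    (hfree : ∀ e ∈ M.E, ∃ A ⊆ M.E \ {e}, e ∉ M.closure A ∧ e ∉ M.closure ((M.E \ {e}) \ A))
    (hcf : ∀ e ∈ M.E, ¬ M.IsColoop e) (hd : M.E.encard = M.eRank + 13) (hn : 39 ≤ M.E.ncard) :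
    {C : Set α | M.IsCircuit C ∧ C.ncard = 4}.ncard ≤ 363 := by
  have h := ncard_fourCircuits_sub_div_le_avgChain16_of_coloopFree M hfree hcf (d := 12) (m := 39)
    (by rw [hd]; norm_num) (by norm_num) hn
  rw [avgChain16_values_cf.2.2.2.2.2.2.1] at h
  omega

/-- **`s₄ ≤ 465` on a coloop-free core of nullity `14` with `≥ 40` points** (`s − ⌊4s/40⌋ ≤ 419`). -/
theorem s4_cf16_14 (M : Matroid α) [M.Finite]
    (hfree : ∀ e ∈ M.E, ∃ A ⊆ M.E \ {e}, e ∉ M.closure A ∧ e ∉ M.closure ((M.E \ {e}) \ A))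
    (hcf : ∀ e ∈ M.E, ¬ M.IsColoop e) (hd : M.E.encard = M.eRank + 14) (hn : 40 ≤ M.E.ncard) :
    {C : Set α | M.IsCircuit C ∧ C.ncard = 4}.ncard ≤ 465 := by
  have h := ncard_fourCircuits_sub_div_le_avgChain16_of_coloopFree M hfree hcf (d := 13) (m := 40)
    (by rw [hd]; norm_num) (by norm_num) hn
  rw [avgChain16_values_cf.2.2.2.2.2.2.2] at h
  omega

/-- **`s₅ ≤ 275` on a coloop-free core of nullity `7` with `≥ 33` points** (`s − ⌊5s/33⌋ ≤ 234`). -/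
theorem s5_cf26_7 (M : Matroid α) [M.Finite]
    (hfree : ∀ e ∈ M.E, ∃ A ⊆ M.E \ {e}, e ∉ M.closure A ∧ e ∉ M.closure ((M.E \ {e}) \ A))
    (hcf : ∀ e ∈ M.E, ¬ M.IsColoop e) (hd : M.E.encard = M.eRank + 7) (hn : 33 ≤ M.E.ncard) :
    {C : Set α | M.IsCircuit C ∧ C.ncard = 5}.ncard ≤ 275 := by
  have h := ncard_fiveCircuits_sub_div_le_avgChain5b_of_coloopFree M hfree hcf (d := 6) (m := 33)
    (by rw [hd]; norm_num) (by norm_num) hn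
  rw [avgChain5b_values_cf.1] at h
  omega

/-- **`s₅ ≤ 470` on a coloop-free core of nullity `8` with `≥ 34` points** (`s − ⌊5s/34⌋ ≤ 401`). -/
theorem s5_cf26_8 (M : Matroid α) [M.Finite]
    (hfree : ∀ e ∈ M.E, ∃ A ⊆ M.E \ {e}, e ∉ M.closure A ∧ e ∉ M.closure ((M.E \ {e}) \ A))
    (hcf : ∀ e ∈ M.E, ¬ M.IsColoop e) (hd : M.E.encard = M.eRank + 8) (hn : 34 ≤ M.E.ncard) :
    {C : Set α | M.IsCircuit C ∧ C.ncard = 5}.ncard ≤ 470 := by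
  have h := ncard_fiveCircuits_sub_div_le_avgChain5b_of_coloopFree M hfree hcf (d := 7) (m := 34)
    (by rw [hd]; norm_num) (by norm_num) hn
  rw [avgChain5b_values_cf.2.1] at h
  omega

/-- **`s₅ ≤ 759` on a coloop-free core of nullity `9` with `≥ 35` points** (`s − ⌊5s/35⌋ ≤ 651`). -/
theorem s5_cf26_9 (M : Matroid α) [M.Finite]
    (hfree : ∀ e ∈ M.E, ∃ A ⊆ M.E \ {e}, e ∉ M.closure A ∧ e ∉ M.closure ((M.E \ {e}) \ A))
    (hcf : ∀ e ∈ M.E, ¬ M.IsColoop e) (hd : M.E.encard = M.eRank + 9) (hn : 35 ≤ M.E.ncard) :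
    {C : Set α | M.IsCircuit C ∧ C.ncard = 5}.ncard ≤ 759 := by
  have h := ncard_fiveCircuits_sub_div_le_avgChain5b_of_coloopFree M hfree hcf (d := 8) (m := 35)
    (by rw [hd]; norm_num) (by norm_num) hn
  rw [avgChain5b_values_cf.2.2.1] at h
  omega

/-- **`s₅ ≤ 1175` on a coloop-free core of nullity `10` with `≥ 36` points** (`s − ⌊5s/36⌋ ≤ 1012`). -/
theorem s5_cf26_10 (M : Matroid α) [M.Finite]
    (hfree : ∀ e ∈ M.E, ∃ A ⊆ M.E \ {e}, e ∉ M.closure A ∧ e ∉ M.closure ((M.E \ {e}) \ A))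
    (hcf : ∀ e ∈ M.E, ¬ M.IsColoop e) (hd : M.E.encard = M.eRank + 10) (hn : 36 ≤ M.E.ncard) :
    {C : Set α | M.IsCircuit C ∧ C.ncard = 5}.ncard ≤ 1175 := by
  have h := ncard_fiveCircuits_sub_div_le_avgChain5b_of_coloopFree M hfree hcf (d := 9) (m := 36)
    (by rw [hd]; norm_num) (by norm_num) hn
  rw [avgChain5b_values_cf.2.2.2.1] at h
  omega

/-- **`s₅ ≤ 1755` on a coloop-free core of nullity `11` with `≥ 37` points** (`s − ⌊5s/37⌋ ≤ 1518`). -/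
theorem s5_cf26_11 (M : Matroid α) [M.Finite]
    (hfree : ∀ e ∈ M.E, ∃ A ⊆ M.E \ {e}, e ∉ M.closure A ∧ e ∉ M.closure ((M.E \ {e}) \ A))
    (hcf : ∀ e ∈ M.E, ¬ M.IsColoop e) (hd : M.E.encard = M.eRank + 11) (hn : 37 ≤ M.E.ncard) :
    {C : Set α | M.IsCircuit C ∧ C.ncard = 5}.ncard ≤ 1755 := by
  have h := ncard_fiveCircuits_sub_div_le_avgChain5b_of_coloopFree M hfree hcf (d := 10) (m := 37)
    (by rw [hd]; norm_num) (by norm_num) hn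
  rw [avgChain5b_values_cf.2.2.2.2.1] at h
  omega

/-- **`s₅ ≤ 2542` on a coloop-free core of nullity `12` with `≥ 38` points** (`s − ⌊5s/38⌋ ≤ 2208`). -/
theorem s5_cf26_12 (M : Matroid α) [M.Finite]
    (hfree : ∀ e ∈ M.E, ∃ A ⊆ M.E \ {e}, e ∉ M.closure A ∧ e ∉ M.closure ((M.E \ {e}) \ A))
    (hcf : ∀ e ∈ M.E, ¬ M.IsColoop e) (hd : M.E.encard = M.eRank + 12) (hn : 38 ≤ M.E.ncard) :
    {C : Set α | M.IsCircuit C ∧ C.ncard = 5}.ncard ≤ 2542 := by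
  have h := ncard_fiveCircuits_sub_div_le_avgChain5b_of_coloopFree M hfree hcf (d := 11) (m := 38)
    (by rw [hd]; norm_num) (by norm_num) hn
  rw [avgChain5b_values_cf.2.2.2.2.2.1] at h
  omega

/-- **`s₅ ≤ 3588` on a coloop-free core of nullity `13` with `≥ 39` points** (`s − ⌊5s/39⌋ ≤ 3128`). -/
theorem s5_cf26_13 (M : Matroid α) [M.Finite]
    (hfree : ∀ e ∈ M.E, ∃ A ⊆ M.E \ {e}, e ∉ M.closure A ∧ e ∉ M.closure ((M.E \ {e}) \ A))
    (hcf : ∀ e ∈ M.E, ¬ M.IsColoop e) (hd : M.E.encard = M.eRank + 13) (hn : 39 ≤ M.E.ncard) :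
    {C : Set α | M.IsCircuit C ∧ C.ncard = 5}.ncard ≤ 3588 := by
  have h := ncard_fiveCircuits_sub_div_le_avgChain5b_of_coloopFree M hfree hcf (d := 12) (m := 39)
    (by rw [hd]; norm_num) (by norm_num) hn
  rw [avgChain5b_values_cf.2.2.2.2.2.2.1] at h
  omega

/-- **`s₅ ≤ 4949` on a coloop-free core of nullity `14` with `≥ 40` points** (`s − ⌊5s/40⌋ ≤ 4331`). -/
theorem s5_cf26_14 (M : Matroid α) [M.Finite]
    (hfree : ∀ e ∈ M.E, ∃ A ⊆ M.E \ {e}, e ∉ M.closure A ∧ e ∉ M.closure ((M.E \ {e}) \ A))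
    (hcf : ∀ e ∈ M.E, ¬ M.IsColoop e) (hd : M.E.encard = M.eRank + 14) (hn : 40 ≤ M.E.ncard) :
    {C : Set α | M.IsCircuit C ∧ C.ncard = 5}.ncard ≤ 4949 := by
  have h := ncard_fiveCircuits_sub_div_le_avgChain5b_of_coloopFree M hfree hcf (d := 13) (m := 40)
    (by rw [hd]; norm_num) (by norm_num) hn
  rw [avgChain5b_values_cf.2.2.2.2.2.2.2] at h
  omega

end ThmN

end PercRepro
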